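/-
Copyright (c) 2026. All rights reserved.
Released under Apache 2.0 license as described in the file LICENSE.
-/
import Literature.Probability.FitznerVanDerHofstad2017.NobleBoundingEventsProduct
import Literature.Probability.FitznerVanDerHofstad2017.NoblePercLetters
import Literature.Probability.FitznerVanDerHofstad2017.NobleBlocksPrime
import HarnessLib

/-!
# Fitzner–van der Hofstad (2017), §6.1 — the nine length classes `(a,b)` and the assembly of (6.4) at `N = 1`

[FvdH17] = R. Fitzner, R. van der Hofstad, *Mean-field behavior for nearest-neighbor percolation in `d > 10`*,
Electron. J. Probab. **22** (2017), no. 43, arXiv:1506.07977v2.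

§6.1 (v2 pp. 58–59) bounds `Ξ^{(1)}_p(x)` by splitting the joint two-level event of (4.65) (`NobleJointTwoLevel`:
`jointWit u v w z t x`) according to the LENGTH CLASSES `a, b ∈ {0, 1, 2}` of the two special lines — the line
`{u ↔ w}` closing the first sausage (`a = 0`: `w = u`; `a = 1`: "u and w are neighbors" and the bond is used;
`a = 2`: a longer connection) and the line `{t ↔ z}` of the last sausage (`b` likewise) — and bounding each class
by the product of blocks `P^{S,a}(u,w) Ā^{ι,a,b}(u,w,t,z) P^{E,b}(t−x,z−x)` ((6.4); App. B tables).

This module fixes the INTERFACE between the nine class estimates and the `x`-space bound (6.4):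

* A. `lineCls a b i k` — the event "the line `{a ↔ b}` read on level `i` is of class `k`"; `clsSet u w t z a b`;
  measurability; the classes cover; `μ(E) ≤ Σ_{a,b} μ(E ∩ class (a,b))`.
* B. **`nobleXiT_one_le_blocks_of_cls`** — the bookkeeping half of (6.4): from the joint two-level form
  `Ξ^{(1)}(x) ≤ Σ_{(u,v)} Σ_{w,z,t} J(v−u) ℙ_p^{⊗2}(E(u,v,w,z,t))` (X1-j2) and ONE estimate per class
  `J(v−u) ℙ_p^{⊗2}(E ∩ class (a,b)) ≤ Σ_ι 𝟙{v = u + e_ι} P^{S,a}(u,w) Ā'^{ι,a,b}(u,w,t,z) P^{E,b}(t−x,z−x)`,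
  conclude `Ξ^{(1)}(x) ≤ Σ_{u,w,t,z} Σ_ι Σ_{a,b} P^{S,a}(u,w) Ā'^{ι,a,b}(u,w,t,z) P^{E,b}(t−x,z−x)` — the hypothesis of
  `NobleBoundsN1Summation.tsum_le_vecPS_matAbarIota_vecPE` (with the primed matrix of `NobleBlocksPrime`).
  The event family `E` and the letters `L` are parameters: the module does not depend on the gate order.
-/

namespace Literature.Probability.FitznerVanDerHofstad2017

open Literature.Barriers.CriticalPhenomena Literature.Probability.Percolation Literature.Probability.LatticeModels
open Literature.Probability.FitznerVanDerHofstad2017.NobleBlocks MeasureTheory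
open scoped ENNReal BigOperators

variable {d : ℕ}

/-! ### A. The length classes -/

/-- **The length class of the line `{a ↔ b}` read on level `i`**: class `0` = the trivial line (`a = b`), class `1`
= `a ≠ b` and the bond `(a,b)` is open on level `i` ("u and w are neighbors", the bond realises the connection),
class `2` = `a ≠ b` and the bond `(a,b)` is NOT open on level `i` (so every witness of the line has length `≥ 2`).
[cite: FitznerVanDerHofstad2017, §6.1 "Case a = 0 / a = 1 / a = 2" (arXiv:1506.07977v2 pp. 58–59)] -/
def lineCls (a b : Site d) (i : Fin 2) (k : Fin 3) : Set (Fin 2 → BondConfig (Site d)) :=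
  match k.val with
  | 0 => {_ω | a = b}
  | 1 => {ω | a ≠ b ∧ s(a, b) ∈ ω i}
  | _ => {ω | a ≠ b ∧ s(a, b) ∉ ω i}

/-- Class `0`: the trivial line. [cite: FitznerVanDerHofstad2017, §6.1 "Case a = 0" (arXiv:1506.07977v2 p. 58)] -/
theorem mem_lineCls_zero_iff (a b : Site d) (i : Fin 2) (ω : Fin 2 → BondConfig (Site d)) :
    ω ∈ lineCls a b i 0 ↔ a = b := Iff.rfl

/-- Class `1`: the open bond. [cite: FitznerVanDerHofstad2017, §6.1 "Case a = 1" (arXiv:1506.07977v2 p. 59)] -/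
theorem mem_lineCls_one_iff (a b : Site d) (i : Fin 2) (ω : Fin 2 → BondConfig (Site d)) :
    ω ∈ lineCls a b i 1 ↔ a ≠ b ∧ s(a, b) ∈ ω i := Iff.rfl

/-- Class `2`: a longer line. [cite: FitznerVanDerHofstad2017, §6.1 "Case a = 2" (arXiv:1506.07977v2 p. 59)] -/
theorem mem_lineCls_two_iff (a b : Site d) (i : Fin 2) (ω : Fin 2 → BondConfig (Site d)) :
    ω ∈ lineCls a b i 2 ↔ a ≠ b ∧ s(a, b) ∉ ω i := Iff.rfl

/-- Every configuration lies in exactly one class of each line; in particular the classes cover. [folklore] -/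
theorem exists_mem_lineCls (a b : Site d) (i : Fin 2) (ω : Fin 2 → BondConfig (Site d)) : ∃ k, ω ∈ lineCls a b i k := by
  classical
  by_cases hab : a = b
  · exact ⟨0, hab⟩
  · by_cases he : s(a, b) ∈ ω i
    · exact ⟨1, hab, he⟩
    · exact ⟨2, hab, he⟩

/-- The classes of a line are measurable (a constant event intersected with a one-bond cylinder). [folklore] -/
theorem measurableSet_lineCls (a b : Site d) (i : Fin 2) (k : Fin 3) : MeasurableSet (lineCls a b i k) := by
  have hcyl : MeasurableSet {ω : Fin 2 → BondConfig (Site d) | s(a, b) ∈ ω i} :=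
    (measurableSet_mem (s(a, b) : Sym2 (Site d))).preimage (measurable_pi_apply i)
  match k with
  | ⟨0, _⟩ => exact MeasurableSet.const _
  | ⟨1, _⟩ => exact (MeasurableSet.const _).inter hcyl
  | ⟨2, _⟩ => exact (MeasurableSet.const _).inter hcyl.compl
  | ⟨k + 3, hk⟩ => exact absurd hk (by omega)

/-- **The class `(a,b)` of §6.1**: class `a` of the line `{u ↔ w}` on level `0` and class `b` of the line `{t ↔ z}`
on level `1`. [cite: FitznerVanDerHofstad2017, §6.1 (6.4) and "Case a = …", "b = …" (arXiv:1506.07977v2 pp. 58–59)] -/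
def clsSet (u w t z : Site d) (a b : Fin 3) : Set (Fin 2 → BondConfig (Site d)) :=
  lineCls u w 0 a ∩ lineCls t z 1 b

/-- Membership (definitional). [cite: FitznerVanDerHofstad2017, §6.1 (arXiv:1506.07977v2 p. 58)] -/
theorem mem_clsSet_iff (u w t z : Site d) (a b : Fin 3) (ω : Fin 2 → BondConfig (Site d)) :
    ω ∈ clsSet u w t z a b ↔ ω ∈ lineCls u w 0 a ∧ ω ∈ lineCls t z 1 b := Iff.rfl

/-- The classes are measurable. [folklore] -/
theorem measurableSet_clsSet (u w t z : Site d) (a b : Fin 3) : MeasurableSet (clsSet u w t z a b) :=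
  (measurableSet_lineCls u w 0 a).inter (measurableSet_lineCls t z 1 b)

/-- The nine classes cover. [cite: FitznerVanDerHofstad2017, §6.1 (arXiv:1506.07977v2 p. 58)] -/
theorem iUnion_clsSet (u w t z : Site d) : ⋃ a, ⋃ b, clsSet u w t z a b = Set.univ := by
  refine Set.eq_univ_of_forall fun ω => ?_
  obtain ⟨a, ha⟩ := exists_mem_lineCls u w 0 ω
  obtain ⟨b, hb⟩ := exists_mem_lineCls t z 1 ω
  exact Set.mem_iUnion.2 ⟨a, Set.mem_iUnion.2 ⟨b, ha, hb⟩⟩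

/-- **Splitting an event into the nine classes**: `μ(E) ≤ Σ_{a,b} μ(E ∩ class (a,b))`.
[cite: FitznerVanDerHofstad2017, §6.1 (6.4) (arXiv:1506.07977v2 p. 58)] -/
theorem measure_le_sum_inter_clsSet (μ : Measure (Fin 2 → BondConfig (Site d))) (E : Set (Fin 2 → BondConfig (Site d)))
    (u w t z : Site d) : μ E ≤ ∑ a : Fin 3, ∑ b : Fin 3, μ (E ∩ clsSet u w t z a b) := by
  have hcov : E ⊆ ⋃ a, ⋃ b, E ∩ clsSet u w t z a b := by
    intro ω hω
    have h := Set.mem_univ ω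
    rw [← iUnion_clsSet u w t z] at h
    obtain ⟨a, ha⟩ := Set.mem_iUnion.1 h
    obtain ⟨b, hb⟩ := Set.mem_iUnion.1 ha
    exact Set.mem_iUnion.2 ⟨a, Set.mem_iUnion.2 ⟨b, hω, hb⟩⟩
  calc μ E ≤ μ (⋃ a, ⋃ b, E ∩ clsSet u w t z a b) := measure_mono hcov
    _ ≤ ∑' a, μ (⋃ b, E ∩ clsSet u w t z a b) := measure_iUnion_le _
    _ ≤ ∑' a, ∑' b, μ (E ∩ clsSet u w t z a b) := ENNReal.tsum_le_tsum fun a => measure_iUnion_le _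
    _ = ∑ a, ∑ b, μ (E ∩ clsSet u w t z a b) := by simp only [tsum_fintype]

/-! ### B. The assembly of (6.4) from the class estimates -/

/-- The `v`-sum eats the indicator `𝟙{v = u + e_ι}` and the finite sums commute out.  [folklore] -/
theorem tsum_sum_ite_eq_sum (u : Site d) (B : Fin d × Bool → Fin 3 → Fin 3 → ℝ≥0∞) :
    ∑' v : Site d, ∑ a : Fin 3, ∑ b : Fin 3, ∑ ι : Fin d × Bool,
      (if v = u + stepVec ι then (1 : ℝ≥0∞) else 0) * B ι a b = ∑ ι, ∑ a, ∑ b, B ι a b := by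
  rw [Summable.tsum_finsetSum (fun a _ => ENNReal.summable)]
  refine (Finset.sum_congr rfl fun a _ => ?_).trans Finset.sum_comm
  rw [Summable.tsum_finsetSum (fun b _ => ENNReal.summable)]
  refine (Finset.sum_congr rfl fun b _ => ?_).trans Finset.sum_comm
  rw [Summable.tsum_finsetSum (fun ι _ => ENNReal.summable)]
  refine Finset.sum_congr rfl fun ι _ => ?_
  simp_rw [boole_mul]
  exact tsum_ite_eq (u + stepVec ι) _

/-- **Bookkeeping of (6.4)**: if `Ξ ≤ Σ_{(u,v)} Σ_{w,z,t} P(u,v,w,z,t)` and, pointwise,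
`P(u,v,w,z,t) ≤ Σ_{a,b} Σ_ι 𝟙{v = u + e_ι} B(ι,a,b,u,w,t,z)`, then `Ξ ≤ Σ_{u,w,t,z} Σ_ι Σ_{a,b} B(ι,a,b,u,w,t,z)`.
[cite: FitznerVanDerHofstad2017, §6.1 (6.4) (arXiv:1506.07977v2 p. 58)] -/
theorem le_tsum_blocks_of_pointwise (Ξ : ℝ≥0∞) (P : Site d → Site d → Site d → Site d → Site d → ℝ≥0∞)
    (B : Fin d × Bool → Fin 3 → Fin 3 → Site d → Site d → Site d → Site d → ℝ≥0∞)
    (h1 : Ξ ≤ ∑' b : Site d × Site d, ∑' w : Site d, ∑' z : Site d, ∑' t : Site d, P b.1 b.2 w z t)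
    (hA : ∀ u v w z t : Site d, P u v w z t ≤
      ∑ a : Fin 3, ∑ b : Fin 3, ∑ ι : Fin d × Bool, (if v = u + stepVec ι then (1 : ℝ≥0∞) else 0) * B ι a b u w t z) :
    Ξ ≤ ∑' u, ∑' w, ∑' t, ∑' z, ∑ ι : Fin d × Bool, ∑ a : Fin 3, ∑ b : Fin 3, B ι a b u w t z := by
  -- sum the pointwise bound
  have hBsum : Ξ ≤ ∑' u : Site d, ∑' v : Site d, ∑' w : Site d, ∑' z : Site d, ∑' t : Site d,
      ∑ a : Fin 3, ∑ b : Fin 3, ∑ ι : Fin d × Bool, (if v = u + stepVec ι then (1 : ℝ≥0∞) else 0) * B ι a b u w t z := by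
    calc Ξ ≤ ∑' b : Site d × Site d, ∑' w : Site d, ∑' z : Site d, ∑' t : Site d,
          ∑ a : Fin 3, ∑ b' : Fin 3, ∑ ι : Fin d × Bool, (if b.2 = b.1 + stepVec ι then (1 : ℝ≥0∞) else 0) * B ι a b' b.1 w t z :=
          h1.trans (ENNReal.tsum_le_tsum fun b => ENNReal.tsum_le_tsum fun w => ENNReal.tsum_le_tsum fun z =>
            ENNReal.tsum_le_tsum fun t => hA b.1 b.2 w z t)
      _ = _ := ENNReal.tsum_prod (f := fun u v => ∑' w : Site d, ∑' z : Site d, ∑' t : Site d,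
          ∑ a : Fin 3, ∑ b' : Fin 3, ∑ ι : Fin d × Bool, (if v = u + stepVec ι then (1 : ℝ≥0∞) else 0) * B ι a b' u w t z)
  -- reorder: bring `v` inside, eliminate it, swap `z` and `t`
  refine hBsum.trans (le_of_eq (tsum_congr fun u => ?_))
  calc ∑' v, ∑' w, ∑' z, ∑' t, ∑ a, ∑ b, ∑ ι, (if v = u + stepVec ι then (1 : ℝ≥0∞) else 0) * B ι a b u w t z
      = ∑' w, ∑' v, ∑' z, ∑' t, ∑ a, ∑ b, ∑ ι, (if v = u + stepVec ι then (1 : ℝ≥0∞) else 0) * B ι a b u w t z :=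
        ENNReal.tsum_comm
    _ = ∑' w, ∑' z, ∑' t, ∑' v, ∑ a, ∑ b, ∑ ι, (if v = u + stepVec ι then (1 : ℝ≥0∞) else 0) * B ι a b u w t z := by
        refine tsum_congr fun w => ?_
        rw [ENNReal.tsum_comm]
        exact tsum_congr fun z => ENNReal.tsum_comm
    _ = ∑' w, ∑' z, ∑' t, ∑ ι, ∑ a, ∑ b, B ι a b u w t z :=
        tsum_congr fun w => tsum_congr fun z => tsum_congr fun t => tsum_sum_ite_eq_sum u fun ι a b => B ι a b u w t z
    _ = ∑' w, ∑' t, ∑' z, ∑ ι, ∑ a, ∑ b, B ι a b u w t z := tsum_congr fun w => ENNReal.tsum_comm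

/-- **[FvdH17] §6.1 (6.4) at `N = 1`, assembly.**  Let `E(u,v,w,z,t)` be events on two levels with
`Ξ^{(1)}_p(x) ≤ Σ_{(u,v)} Σ_{w,z,t} J(v−u) ℙ_p^{⊗2}(E(u,v,w,z,t))` (the joint two-level form of (4.65),
`NobleJointTwoLevel.nobleXiT_one_le_tsum_pi_jointWit`), and suppose the CLASS ESTIMATES: for every class `(a,b)`,
`J(v−u) ℙ_p^{⊗2}(E(u,v,w,z,t) ∩ class (a,b)) ≤ Σ_ι 𝟙{v = u + e_ι} P^{S,a}(u,w) Ā'^{ι,a,b}(u,w,t,z) P^{E,b}(t−x,z−x)`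
("we bound the event … by the diagrams of Appendix B", cases `a, b = 0, 1, 2`).  Then
`Ξ^{(1)}_p(x) ≤ Σ_{u,w,t,z} Σ_ι Σ_{a,b} P^{S,a}(u,w) Ā'^{ι,a,b}(u,w,t,z) P^{E,b}(t−x,z−x)` — the `x`-space bound (6.4)
(hypothesis `hΞ` of `NobleBoundsN1Summation.tsum_le_vecPS_matAbarIota_vecPE`, primed matrix `Ā'`).
[cite: FitznerVanDerHofstad2017, §6.1 (6.4) (arXiv:1506.07977v2 p. 58); App. B (pp. 73–78)] -/
theorem nobleXiT_one_le_blocks_of_cls (L : Letters d) (p : unitInterval) (x : Site d)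
    (E : Site d → Site d → Site d → Site d → Site d → Set (Fin 2 → BondConfig (Site d)))
    (h1 : nobleXiT d p 1 x ≤ ∑' b : Site d × Site d, ∑' w : Site d, ∑' z : Site d, ∑' t : Site d,
      ENNReal.ofReal (bondJ d p (b.2 - b.1)) * piPerc d p 2 (E b.1 b.2 w z t))
    (h2 : ∀ (a b : Fin 3) (u v w z t : Site d),
      ENNReal.ofReal (bondJ d p (v - u)) * piPerc d p 2 (E u v w z t ∩ clsSet u w t z a b) ≤
        ∑ ι : Fin d × Bool, (if v = u + stepVec ι then (1 : ℝ≥0∞) else 0) *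
          (blockPS L a u w * blockAbar' L ι a b u w t z * blockPE L b (t - x) (z - x))) :
    nobleXiT d p 1 x ≤ ∑' u, ∑' w, ∑' t, ∑' z, ∑ ι : Fin d × Bool, ∑ a : Fin 3, ∑ b : Fin 3,
      blockPS L a u w * blockAbar' L ι a b u w t z * blockPE L b (t - x) (z - x) := by
  refine le_tsum_blocks_of_pointwise (nobleXiT d p 1 x)
    (fun u v w z t => ENNReal.ofReal (bondJ d p (v - u)) * piPerc d p 2 (E u v w z t))
    (fun ι a b u w t z => blockPS L a u w * blockAbar' L ι a b u w t z * blockPE L b (t - x) (z - x)) h1 ?_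
  intro u v w z t
  calc ENNReal.ofReal (bondJ d p (v - u)) * piPerc d p 2 (E u v w z t)
      ≤ ENNReal.ofReal (bondJ d p (v - u)) * ∑ a, ∑ b, piPerc d p 2 (E u v w z t ∩ clsSet u w t z a b) :=
        mul_le_mul' le_rfl (measure_le_sum_inter_clsSet _ _ u w t z)
    _ = ∑ a, ∑ b, ENNReal.ofReal (bondJ d p (v - u)) * piPerc d p 2 (E u v w z t ∩ clsSet u w t z a b) := by
        rw [Finset.mul_sum]; exact Finset.sum_congr rfl fun a _ => Finset.mul_sum _ _ _
    _ ≤ ∑ a, ∑ b, ∑ ι, (if v = u + stepVec ι then (1 : ℝ≥0∞) else 0) *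
          (blockPS L a u w * blockAbar' L ι a b u w t z * blockPE L b (t - x) (z - x)) :=
        Finset.sum_le_sum fun a _ => Finset.sum_le_sum fun b _ => h2 a b u v w z t

end Literature.Probability.FitznerVanDerHofstad2017
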